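import Summits.AtomisticToContinuum.HydrodynamicLimit.Theses.InformationPercolationEngine
import Literature.MathematicalPhysics.KineticTheory.StochasticCollisionHardSphereProcess
import Literature.Analysis.FluidPDE.DicedHardSphereDynamics
import Literature.Analysis.FluidPDE.HardSphereFlowConstruction
import Literature.MathematicalPhysics.KineticTheory.HardSphereEulerProofs

/-!
# Line `stein-lindeberg-kick-swap` — skeleton for the crux `InformationPercolationEngine.PercolationClosesChaos`
(crux item stmt-AtomisticToContinuum-13914, rank 4; route `route-AtomisticToContinuum-InformationPercolationEngine`,
rev 3/4). Crux-plan seat `planner-cruxplan-stmt-AtomisticToContinuum-13914-stein-lindeberg-kick-0`, 2026-08-16.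
LEAD'S RESHAPE v2 (prover-line-stmt-AtomisticToContinuum-13914-0, 2026-08-16): the planner's W and S3 are split at the
skeleton level — W = W1 `KickMatchedMeasurable` ∧ W2 `KickMatchedStationaryCore` (glue `kickMatchedStationary_of`), S3 =
S3a `SwapIdentity` ∧ S3b `SwapSumDomination` (glue `kickAmbientDomination_of`, PROVED: smoothing sandwich + two Markov
steps) — so the registered stubs are the six `stub_kickMatchedMeasurable`, `stub_kickMatchedStationaryCore`,
`stub_fairGasContactChaos`, `stub_oneKickInfluence`, `stub_swapIdentity`, `stub_swapSumDomination`; the planner's 4-ary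
composition survives verbatim as `PercolationClosesChaos_of₄`, and `PercolationClosesChaos_of` is its 6-ary refinement.
See `## Reshaped stubs` below for the statements and why S3a is exactly true. Extra import: `HardSphereEulerProofs`
(`isProbabilityMeasure_localGibbsLaw`, used by the glue).

Crux (FIXED, by name): `PercolationClosesChaos : KickIsotropyInfo → SpectralContractionR → ContactChaos`.

Idea (crux idea `stein-lindeberg-kick-swap`, ideator 1, round 1; triage r1: k1 pass (doubt noted), k2 pass, k3 pass).
Swap the TRUE deterministic kicks for FAIR kicks one contact at a time in chronological order (true past, random
future) against a KICK-MATCHED comparison gas `Z*`: at each geometric contact the contact NORMAL is resampled from the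
flux law on ADMISSIBLE normals (the partner is re-placed at `x_i − εω'`, an `O(ε)` move that keeps the hard-core Gibbs
law invariant), then the pair reflects specularly — so the one-collision velocity law of `Z*` is the uniform redirection
that `KickIsotropyInfo` certifies for the true gas (Disproof §5b), partner SELECTION is the same geometric mechanism in
both gases and is never assumed, and the whole difference `ContactChaos(true) − ContactChaos(Z*)` is charged kick by
kick to one-kick swap terms (`stein_lindeberg_identity`, proved here). Each swap term splits into a part that typed
`KickIsotropyInfo` pays VERBATIM with its tamest weights `h = s(v, w)` (blind to the third-body-shielding witness of
Disproof F2: the line docks on the repaired `KickMacro` class only) and ONE residual, the kick–ambient conspiracy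
(history-free, equilibrium-null by Palm with the RESTRICTED reference, carried by instantaneous 3-clusters).
`SpectralContractionR` is the resolvent bound of the Stein factor (a GAP is all that is used: Disproof F3 does not bite).

THE LINE, TYPED (4 registered stubs + the kernel-checked composition):
* vocabulary (local `def`s over tree declarations only; a definition request `KickMatchedHardSphereGas` is filed so that
  they can move to the tree as `CollisionTubeFunctional` did for OddContactSymmetry): `defect` = the crux's cross-ratio
  defect as a functional of a PATH (the crux's `let`-chain verbatim; `contactChaos_iff : ContactChaos ↔ …` is
  `Iff.rfl`), `kickFunctional` (+ `kickIsotropyInfo_iff`, `Iff.rfl`), `velWeight` (the `(v, w)`-weights as typed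
  coarse-past weights, `measurable_velWeight`); `Z*`: `kickAt`, `IsAdmissible`, `kmNormal` (rejection sampling of the
  admissible flux law from uniform disc points via `Lambert.lift`), `kmRule`, `kmFlow = Driven.flow …`, `discLaw`,
  `kmDice`, `starDefect`; the swap: `collTime/numColl/postAt/pairAt/preAt/trueKick` (collision enumeration of the
  orbit), `contPath` (true past, `Z*` future), `phiEta`, `swapValue` (dice-expectation = random-future value function),
  `influence`, `fluxLaw`, `restrictedMean`, `swapIntegrand` (RESTRICTED reference), `swapSum`.
* `stub_kickMatchedStationary` (W, M–L, the CONSTRUCTION statement of the posited object; first milestone): `Z*` is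
  measurable, leaves the homogeneous Gibbs law invariant (stationary, NOT reversible — TRIAGE-r1-2), a.s. no
  accumulation, unique incoming pair, terminating sampler.
* `stub_fairGasContactChaos` (S1, XL open): W → ContactChaos-in-probability for `Z*` (same functional, `localGibbsLaw ⊗
  kmDice`). The Transfer's premise; why easier: Markov gas, explicit stationary law, independent node noise.
* `stub_oneKickInfluence` (S2, M–L): `SpectralContractionR → W →` Lindeberg-type uniform integrability of the one-kick
  influences at scale `ε/(N+1)` (the Stein factor: gap + exact conservation `outgoing_momentum_eq`/`outgoing_energy_eq`).
* `stub_kickAmbientDomination` (S3, XL open — HARDEST, the line's exposure): W → S2 → for all data,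
  `lG{η < |D_true|} ≤ (lG ⊗ kmDice){η/2 < |D_{Z*}|} + δ + C Σ_{m<m₀} ‖kickFunctional (g m) (velWeight (s m))‖_{L¹(lG)}`
  with a finite dictionary `g_m` of continuous bounded flux-mean-zero tests chosen BEFORE `N` and measurable `|s_m| ≤ 1`
  chosen after — swap identity + dictionary expansion + the kick–ambient conspiracy `→ 0` (booked as the `δ`).
* `PercolationClosesChaos_of : Stubs.stub_W → Stubs.stub_S1 → Stubs.stub_S2 → Stubs.stub_S3 → PercolationClosesChaos`
  (REAL proof: thresholds `σ₀ := min`, S1 at `(η/2, δ/3)`, S3 at `(η, δ/3, r)`, typed Kick at scale `r` with weights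
  `velWeight (s m)` and accuracy `δ/(3(C+1)(m₀+1))` uniformly in the weights, `N₀ := max`, `budget_le`; `Spec` feeds S2)
  and `PercolationClosesChaos_proof : PercolationClosesChaos` from the four `stub_*` by name. `lean check`: rc 0, sorries
  only in the four `stub_*`; `#h21_check_skeleton`: ok, theorem `PercolationClosesChaos_of`, codes [].

## Disproof used (`Cruxes/PercolationClosesChaos/Disproof.lean` v3 @dd2d993933c0, read 2026-08-16)
* §1 `not_crux_iff`, `not_withoutKick_iff`, `not_withoutSpectral_iff`: no `_false_without_` obstruction exists for this
  dock; the line nevertheless USES both hypotheses — Kick in the composition (velocity weights), Spec in S2.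
* F2 (typed Kick false in equilibrium by third-body shielding): HONOURED — the only weights spent are `velWeight s`,
  functions of the two pre-collisional velocities, on which Kick is Palm-exact in equilibrium; the finer conditioning
  the line needs lives in S3 with the RESTRICTED admissible reference (`restrictedMean`, `swapIntegrand`), under which
  the shielding stratum is booked correctly (the empty cap is exactly the inadmissible set).
* F3 (spectral input mis-docked in power and class): does not bite — S2 uses `SpectralContractionR` as a gap only; no
  census in the corrected currency is run on the deterministic gas (if S1 is proved by a census ON `Z*`, the F3(c′)
  input `SpectralContractionOffInvariants` and F3(d) apply there, as the card says).
* §4 `kosRun_perm` (keep-or-swap forgets nothing): for atomic/1-D kinematics the "fair" kick is atomic, `Z*` = the true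
  gas and S2 fails (no gap) — the line runs on complete 3-D redirection (§5b `collide_fst_eq_cm`, `norm_half_sub_reflect`).
* No lemma has landed under `Theorems/PercolationClosesChaos/Negative/` (nothing to import); negatives index (12):
  13479 avoided (only the measurable `SpectralContractionR`, by name).
-/

noncomputable section

namespace Summit.AtomisticToContinuum.HydrodynamicLimit.Cruxes.PercolationClosesChaos.SteinLindebergKickSwap

open scoped BigOperators ENNReal Topology RealInnerProductSpace
open MeasureTheory Set Filter
open Literature.MathematicalPhysics.KineticTheory
open Literature.Analysis.FluidPDE
open Summit.AtomisticToContinuum.HydrodynamicLimit.Theses.InformationPercolationEngine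

/-! ## Frame -/

/-- Phase space of `N + 1` hard spheres on `𝕋³`. [folklore] -/
abbrev Cfg (N : ℕ) : Type := Config (N + 1) (Fin 3) T3

/-- Hard-sphere flows on `𝕋³` at reduced diameter `σ` (diameter `hsDiameter σ N`). [folklore] -/
abbrev Flow (σ : ℝ) (N : ℕ) : Type := HardSphereFlow (Torus.geometry (Fin 3)) (hsDiameter σ N) (N + 1)

/-- The torus geometry of `𝕋³` (minimal-image separation vectors). [folklore] -/
abbrev geo : Geometry (Fin 3) T3 := Torus.geometry (Fin 3)

/-! ## The crux's defect functional as a functional of a PATH -/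

/-- **The cross-ratio chaos defect** `D = K_N[χ·Ψ·A_r] − K_N[χ·B^Ψ_r]` of the crux target `ContactChaos`
(stmt-AtomisticToContinuum-13477), VERBATIM the crux's `let`-chain but written as a functional of an arbitrary
(right-continuous, post-collisional) path `γ : ℝ → Cfg N` instead of the orbit `s ↦ (Φ N).flow s z` — so that the
SAME functional is evaluated on the deterministic gas, on the kick-matched comparison gas `Z*` and on the hybrids of
the Lindeberg swap. `contactChaos_iff` is the `Iff.rfl` bridge. [folklore] -/
def defect (σ : ℝ) (N : ℕ) (τ : ℝ) (χ : ℝ × T3 → ℝ) (Ψ : V3 × V3 × V3 → ℝ) (r : ℝ) (γ : ℝ → Cfg N) : ℝ :=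
  let ε := hsDiameter σ N
  let G : Geometry (Fin 3) T3 := Torus.geometry (Fin 3)
  let bx : T3 → T3 → ℝ := fun x y => 3 / (Real.pi * r ^ 3) * max (1 - Torus.euclidDist x y / r) 0
  let bt : ℝ → ℝ := fun a => r⁻¹ * max (1 - |a| / r) 0
  let Θ := fun (Ξ : V3 × V3 × V3 → ℝ) (v w : V3) => ∫ ω : Metric.sphere (0 : V3) 1, Ξ ((ω : V3), v, w) * hardSphereKernel (w, v) ω ∂sphereMeasure
  let Pm : (V3 → V3 → ℝ) → ℝ → T3 → ℝ := fun Th s₀ x₀ => ∫ s in Set.Icc (0 : ℝ) τ, bt (s - s₀) * ∫ p, bx p.1.1 x₀ * bx p.2.1 x₀ * Th p.1.2 p.2.2 ∂((empiricalMeasure (γ s)).prod (empiricalMeasure (γ s)))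
  let Kc : (ℝ → Fin (N + 1) → Fin (N + 1) → ℝ) → ℝ := fun F => ε / (N + 1 : ℝ) * ∑ᶠ (s : ℝ) (_ : s ∈ collisionTimes G ε γ ∩ Set.Icc 0 τ), ∑ i : Fin (N + 1), ∑ j : Fin (N + 1), (if i ≠ j ∧ ‖G.sepVec (γ s i).1 (γ s j).1‖ = ε then F s i j else 0)
  let pv : ℝ → Fin (N + 1) → Fin (N + 1) → V3 × V3 := fun s i j => reflectVel (G.sepVec (γ s i).1 (γ s j).1) ((γ s i).2, (γ s j).2)
  Kc (fun s i j => χ (s, (γ s i).1) * Ψ (ε⁻¹ • G.sepVec (γ s i).1 (γ s j).1, (pv s i j).1, (pv s i j).2) * Pm (Θ (fun _ => 1)) s (γ s i).1) - Kc (fun s i _ => χ (s, (γ s i).1) * Pm (Θ Ψ) s (γ s i).1)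

/-- The defect of the DETERMINISTIC gas: `defect` on the orbit of `z` under `Φ`. [folklore] -/
abbrev trueDefect (σ : ℝ) (N : ℕ) (Φ : Flow σ N) (τ : ℝ) (χ : ℝ × T3 → ℝ) (Ψ : V3 × V3 × V3 → ℝ) (r : ℝ)
    (z : Cfg N) : ℝ :=
  defect σ N τ χ Ψ r fun s => Φ.flow s z

set_option maxHeartbeats 4000000 in
/-- `ContactChaos` restated over `trueDefect` — definitionally the crux target (the `let γ := fun z s => (Φ N).flow s z`
of the crux β-reduces to the orbit path). [folklore] -/
theorem contactChaos_iff :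
    ContactChaos ↔
      ∀ (a₀ θ₀ : T3 → ℝ) (u₀ : T3 → V3), Continuous a₀ → Continuous θ₀ → Continuous u₀ → (∀ x, 0 < a₀ x) →
        (∀ x, 0 < θ₀ x) → ∃ σ₀ : ℝ, 0 < σ₀ ∧ ∀ σ : ℝ, 0 < σ → σ < σ₀ → ∀ Φ : (N : ℕ) → Flow σ N,
        ∀ τ : ℝ, 0 < τ → ∀ χ : ℝ × T3 → ℝ, Continuous χ → ∀ Ψ : V3 × V3 × V3 → ℝ, Continuous Ψ →
        (∃ C : ℝ, ∀ p, |Ψ p| ≤ C) → ∀ η δ : ℝ, 0 < η → 0 < δ → ∃ r₀ : ℝ, 0 < r₀ ∧ ∀ r : ℝ, 0 < r → r < r₀ →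
        ∃ N₀ : ℕ, ∀ N : ℕ, N₀ ≤ N →
          localGibbsLaw σ a₀ u₀ θ₀ N (Φ N) {z | η < |trueDefect σ N (Φ N) τ χ Ψ r z|} ≤ ENNReal.ofReal δ :=
  Iff.rfl

/-! ## The typed functional of `KickIsotropyInfo` -/

/-- The type of the coarse-past weights of `KickIsotropyInfo`: `h i n (coarse past, partner label)` for the `n`-th
collision of sphere `i` (two coarse snapshots — `r`-cells and exact velocities of all spheres at the starts of the two
flights ending in that collision — and the partner's label). [folklore] -/
abbrev PastWeight (N : ℕ) : Type :=
  Fin (N + 1) → ℕ → ((Fin (N + 1) → (Fin 3 → ℤ) × V3) × (Fin (N + 1) → (Fin 3 → ℤ) × V3)) × Fin (N + 1) → ℝ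

/-- A kick test `g(ω, v, w)` has zero flux mean on the incoming hemisphere: `∫ g(ω,v,w) ((w−v)·ω)₊ dω = 0` for all
`v, w` (the side condition of `KickIsotropyInfo`, verbatim). [folklore] -/
def IsFluxMeanZero (g : V3 × V3 × V3 → ℝ) : Prop :=
  ∀ v w : V3, ∫ ω : Metric.sphere (0 : V3) 1, g ((ω : V3), v, w) * hardSphereKernel (w, v) ω ∂sphereMeasure = 0

/-- **The normalised weighted collision sum of `KickIsotropyInfo`** (stmt-AtomisticToContinuum-13478), VERBATIM its
`let`-chain: `(ε/(N+1)) Σ_i Σ_{n < #collisions of i in (0,τ]} h_{i,n}(coarse past, partner) · g(ω_{i,n}, v⁻, v*⁻)`.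
`kickIsotropyInfo_iff` is the `Iff.rfl` bridge. [folklore] -/
def kickFunctional (σ : ℝ) (N : ℕ) (Φ : Flow σ N) (τ r : ℝ) (g : V3 × V3 × V3 → ℝ) (h : PastWeight N)
    (z : Cfg N) : ℝ :=
  let ε := hsDiameter σ N
  let G : Geometry (Fin 3) T3 := Torus.geometry (Fin 3)
  let q : T3 → (Fin 3 → ℤ) := Torus.coarseCell r
  let cnt : Cfg N → Fin (N + 1) → ℕ := fun z i => Set.ncard (collisionTimesOf G ε (fun t => Φ.flow t z) i ∩ Set.Ioc 0 τ)
  let c := fun (z : Cfg N) (i : Fin (N + 1)) (n : ℕ) => Φ.nthRecordOf i n z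
  ε / (N + 1 : ℝ) * ∑ i : Fin (N + 1), ∑ n ∈ Finset.range (cnt z i), h i n (Φ.coarsePastOf q i n z, Φ.nthPartnerOf i n z) * g ((c z i n).impactVec, (c z i n).preVel.1, (c z i n).preVel.2)

set_option maxHeartbeats 4000000 in
/-- `KickIsotropyInfo` restated over `kickFunctional` — definitionally crux 2. [folklore] -/
theorem kickIsotropyInfo_iff :
    KickIsotropyInfo ↔
      ∀ (a₀ θ₀ : T3 → ℝ) (u₀ : T3 → V3), Continuous a₀ → Continuous θ₀ → Continuous u₀ → (∀ x, 0 < a₀ x) →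
        (∀ x, 0 < θ₀ x) → ∃ σ₀ : ℝ, 0 < σ₀ ∧ ∀ σ : ℝ, 0 < σ → σ < σ₀ → ∀ Φ : (N : ℕ) → Flow σ N,
        ∀ τ : ℝ, 0 < τ → ∀ r : ℝ, 0 < r → ∀ g : V3 × V3 × V3 → ℝ, Continuous g → (∃ C : ℝ, ∀ p, |g p| ≤ C) →
        IsFluxMeanZero g → ∀ δ : ℝ, 0 < δ → ∃ N₀ : ℕ, ∀ N : ℕ, N₀ ≤ N → ∀ h : PastWeight N,
        (∀ i n, Measurable (h i n)) → (∀ i n p, |h i n p| ≤ 1) →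
          ∫⁻ z, ENNReal.ofReal |kickFunctional σ N (Φ N) τ r g h z| ∂(localGibbsLaw σ a₀ u₀ θ₀ N (Φ N)) ≤
            ENNReal.ofReal δ :=
  Iff.rfl

/-- The TAMEST weights in `KickIsotropyInfo`'s class, the only ones this line spends: a measurable function `s` of the
two pre-collisional velocities, read off the coarse past (velocity of `i` in the first snapshot, velocity of the
partner `l` in the second — velocities do not change along a free flight). Blind to fine geometry, history and labels,
hence blind to the third-body-shielding witness of Disproof F2 (`KickMacro` of the card). [folklore] -/
def velWeight (N : ℕ) (s : V3 × V3 → ℝ) : PastWeight N :=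
  fun i _ p => s ((p.1.1 i).2, (p.1.2 p.2).2)

/-- `velWeight` is a measurable weight family. [folklore] -/
theorem measurable_velWeight {N : ℕ} {s : V3 × V3 → ℝ} (hs : Measurable s) (i : Fin (N + 1)) (n : ℕ) :
    Measurable (velWeight N s i n) := by
  unfold velWeight
  refine hs.comp (Measurable.prodMk ?_ ?_)
  · exact measurable_snd.comp ((measurable_pi_apply i).comp (measurable_fst.comp measurable_fst))
  · have : Measurable fun p : ((Fin (N + 1) → (Fin 3 → ℤ) × V3) × (Fin (N + 1) → (Fin 3 → ℤ) × V3)) ×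
        Fin (N + 1) => (p.1.2 p.2).2 :=
      measurable_from_prod_countable_left fun l =>
        measurable_snd.comp ((measurable_pi_apply l).comp measurable_snd)
    exact this

/-- `|velWeight| ≤ 1` when `|s| ≤ 1`. [folklore] -/
theorem abs_velWeight_le {N : ℕ} {s : V3 × V3 → ℝ} (hs : ∀ p, |s p| ≤ 1) (i : Fin (N + 1)) (n : ℕ)
    (p : ((Fin (N + 1) → (Fin 3 → ℤ) × V3) × (Fin (N + 1) → (Fin 3 → ℤ) × V3)) × Fin (N + 1)) :
    |velWeight N s i n p| ≤ 1 :=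
  hs _

/-! ## The kick-matched comparison gas `Z*` -/

/-- The die thrown at ONE collision of `Z*`: a sequence of points of `ℝ²` (i.i.d. uniform on the unit disc under
`kmDice`), consumed by rejection sampling of an ADMISSIBLE normal. [folklore] -/
abbrev Die : Type := ℕ → EuclideanSpace ℝ (Fin 2)

/-- The uniform probability law on the closed unit disc of `ℝ²` (Lebesgue measure restricted and normalised); its
push-forward under Lambert's lift `Lambert.lift a` is the flux (Knudsen cosine) law `⟪ω, a⟫₊ dσ(ω)` of the hemisphere
about `a`, normalised (`Literature.Analysis.FluidPDE.Lambert`, DicedHardSphereDynamics). [folklore] -/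
def discLaw : Measure (EuclideanSpace ℝ (Fin 2)) :=
  (volume (Metric.closedBall (0 : EuclideanSpace ℝ (Fin 2)) 1))⁻¹ •
    volume.restrict (Metric.closedBall (0 : EuclideanSpace ℝ (Fin 2)) 1)

instance isProbabilityMeasure_discLaw : IsProbabilityMeasure discLaw := by
  have h0 : volume (Metric.closedBall (0 : EuclideanSpace ℝ (Fin 2)) 1) ≠ 0 :=
    (Metric.measure_closedBall_pos volume _ one_pos).ne'
  have h1 : volume (Metric.closedBall (0 : EuclideanSpace ℝ (Fin 2)) 1) ≠ ∞ := measure_closedBall_lt_top.ne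
  refine ⟨?_⟩
  simp only [discLaw, Measure.smul_apply, Measure.restrict_apply_univ, smul_eq_mul]
  exact ENNReal.inv_mul_cancel h0 h1

/-- The law of ALL dice of `Z*`: one independent `Die` per collision, each an i.i.d. uniform-disc sequence
(`KernelGas.dice` twice: `(discLaw^{⊗ℕ})^{⊗ℕ}`). [folklore] -/
def kmDice : Measure (ℕ → Die) :=
  KernelGas.dice (KernelGas.dice discLaw)

instance isProbabilityMeasure_kmDice : IsProbabilityMeasure kmDice := by
  unfold kmDice; infer_instance

/-- **Resolve a contact of the ordered pair `(i, j)` of `y` with the (unit) normal `ω`**: RE-PLACE the partner `j` at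
contact along `ω` from the centre of `i` (`x_j := x_i − ε ω`, an `O(ε)` move — the price of keeping the hard-core
Gibbs law invariant), then reflect the pair SPECULARLY about `ω` (`collidePair`, whose separation vector is now `ε ω`).
For `ω` = the true impact vector this is the true elastic collision (`x_j` is where it was). [folklore] -/
def kickAt (σ : ℝ) (N : ℕ) (i j : Fin (N + 1)) (ω : V3) (y : Cfg N) : Cfg N :=
  collidePair geo i j (Function.update y j (geo.translate (y i).1 (-(hsDiameter σ N • ω)), (y j).2))

/-- A normal `ω` is ADMISSIBLE for the pair `(i, j)` of the pre-collisional configuration `y`: unit, on the incoming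
hemisphere (`(w − v)·ω > 0`, `v = v_i`, `w = v_j` — the support of the flux law `hardSphereKernel (w, v) ω`), and the
re-placed configuration has no overlap (`hardSphereDomain`). The RESTRICTED reference of the card / triage lives on
this set (an unrestricted redraw mis-books the shielding stratum, card falsifier (d)). [folklore] -/
def IsAdmissible (σ : ℝ) (N : ℕ) (i j : Fin (N + 1)) (ω : V3) (y : Cfg N) : Prop :=
  ‖ω‖ = 1 ∧ 0 < ⟪(y j).2 - (y i).2, ω⟫ ∧ kickAt σ N i j ω y ∈ hardSphereDomain geo (N + 1) (hsDiameter σ N)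

open Classical in
/-- **The resampled normal** of `Z*` at a contact of `(i, j)` in `y`, driven by the die `d`: REJECTION SAMPLING of the
flux law restricted to admissible normals — the candidates `Lambert.lift a (d n)` (`a = (w − v)/|w − v|`; a uniform disc
point lifted to the hemisphere about `a` is flux-distributed) are scanned and the first admissible one is taken. Junk
(the true normal `ε⁻¹(x_i − x_j)`) if no candidate is admissible — a `kmDice`-null event whenever the admissible set has
positive flux measure. [folklore] -/
def kmNormal (σ : ℝ) (N : ℕ) (i j : Fin (N + 1)) (y : Cfg N) (d : Die) : V3 :=
  let a : V3 := ‖(y j).2 - (y i).2‖⁻¹ • ((y j).2 - (y i).2)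
  if h : ∃ n : ℕ, ‖d n‖ ≤ 1 ∧ IsAdmissible σ N i j (Lambert.lift a (d n)) y then Lambert.lift a (d (Nat.find h))
  else (hsDiameter σ N)⁻¹ • geo.sepVec (y i).1 (y j).1

/-- The pair rule of `Z*` (a `Driven` rule with noise space `Die`): resolve the contact with the resampled normal.
[folklore] -/
def kmRule (σ : ℝ) (N : ℕ) : Fin (N + 1) → Fin (N + 1) → Cfg N → Die → Cfg N :=
  fun i j y d => kickAt σ N i j (kmNormal σ N i j y d) y

/-- **The kick-matched gas `Z*`**: free flight to the next geometric contact (`Alexander.freeExitTime`, same partner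
SELECTION as the deterministic gas), then `kmRule` with a fresh die — the library's `Driven.flow` (right-continuous,
forward in time), as a deterministic function of the initial datum `z` and of the dice `u`. [folklore] -/
def kmFlow (σ : ℝ) (N : ℕ) (u : ℕ → Die) (z : Cfg N) (t : ℝ) : Cfg N :=
  Driven.flow geo (hsDiameter σ N) (kmRule σ N) u z t

/-- The defect of the COMPARISON gas: `defect` on the `Z*` path from `q.1` with dice `q.2`. [folklore] -/
abbrev starDefect (σ : ℝ) (N : ℕ) (τ : ℝ) (χ : ℝ × T3 → ℝ) (Ψ : V3 × V3 × V3 → ℝ) (r : ℝ)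
    (q : Cfg N × (ℕ → Die)) : ℝ :=
  defect σ N τ χ Ψ r fun s => kmFlow σ N q.2 q.1 s

/-! ## The chronological one-kick swap (vocabulary of S2 / S3) -/

/-- The `k`-th collision time in `(0, ∞)` of the orbit of `z` (`k = 0` the first; junk beyond the last). [folklore] -/
def collTime (σ : ℝ) (N : ℕ) (Φ : Flow σ N) (z : Cfg N) (k : ℕ) : ℝ :=
  nthCollisionTime geo (hsDiameter σ N) (fun t => Φ.flow t z) 0 k

/-- Number of collisions of the orbit of `z` in `(0, τ]`. [folklore] -/
def numColl (σ : ℝ) (N : ℕ) (Φ : Flow σ N) (τ : ℝ) (z : Cfg N) : ℕ :=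
  Set.ncard (collisionTimes geo (hsDiameter σ N) (fun t => Φ.flow t z) ∩ Set.Ioc 0 τ)

/-- The post-collisional configuration at the `k`-th collision (the orbit is right-continuous). [folklore] -/
def postAt (σ : ℝ) (N : ℕ) (Φ : Flow σ N) (z : Cfg N) (k : ℕ) : Cfg N :=
  Φ.flow (collTime σ N Φ z k) z

open Classical in
/-- The colliding pair `(i, j)`, `i < j`, of the `k`-th collision (junk `(0, 0)` if none is in contact). [folklore] -/
def pairAt (σ : ℝ) (N : ℕ) (Φ : Flow σ N) (z : Cfg N) (k : ℕ) : Fin (N + 1) × Fin (N + 1) :=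
  let S := (contactPairs geo (hsDiameter σ N) (postAt σ N Φ z k)).filter fun p => p.1 < p.2
  if h : S.Nonempty then h.choose else (0, 0)

/-- The PRE-collisional configuration of the `k`-th collision, recovered from the post-collisional one by the
involution `collidePair` (= the left limit of the orbit, `IsHardSphereTrajectory.eq_collidePair_leftLim`). [folklore] -/
def preAt (σ : ℝ) (N : ℕ) (Φ : Flow σ N) (z : Cfg N) (k : ℕ) : Cfg N :=
  collidePair geo (pairAt σ N Φ z k).1 (pairAt σ N Φ z k).2 (postAt σ N Φ z k)

/-- The TRUE impact vector `ω_k = ε⁻¹ (x_i − x_j)` of the `k`-th collision. [folklore] -/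
def trueKick (σ : ℝ) (N : ℕ) (Φ : Flow σ N) (z : Cfg N) (k : ℕ) : V3 :=
  (hsDiameter σ N)⁻¹ •
    geo.sepVec ((postAt σ N Φ z k) (pairAt σ N Φ z k).1).1 ((postAt σ N Φ z k) (pairAt σ N Φ z k).2).1

/-- **The continuation path of the `k`-th swap**: the TRUE orbit strictly before the `k`-th collision time, then the
`Z*` path (dice `u`) restarted from the pre-collisional configuration resolved with the kick `ω` (true past, random
future; with `ω = trueKick` and `Z*` replaced by `Φ` this would be the orbit itself). [folklore] -/
def contPath (σ : ℝ) (N : ℕ) (Φ : Flow σ N) (z : Cfg N) (k : ℕ) (ω : V3) (u : ℕ → Die) (s : ℝ) : Cfg N :=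
  if s < collTime σ N Φ z k then Φ.flow s z
  else kmFlow σ N u (kickAt σ N (pairAt σ N Φ z k).1 (pairAt σ N Φ z k).2 ω (preAt σ N Φ z k))
    (s - collTime σ N Φ z k)

/-- The smoothed indicator `φ_η(x) = min 1 ((|x| − η)₊ / η)`: `η⁻¹`-Lipschitz, `= 1` on `|x| ≥ 2η`, `= 0` on `|x| ≤ η`,
values in `[0, 1]` — the bounded Lipschitz statistic through which "in probability" is compared. [folklore] -/
def phiEta (η x : ℝ) : ℝ :=
  min 1 (max (|x| - η) 0 / η)

/-- **The `Z*`-value of resolving the `k`-th TRUE collision with the kick `ω`**: the dice-expectation of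
`φ_η ∘ defect` of the continuation path (the "random-future value function" `U_{k+1}(T_ω z_k)` of the card). [folklore] -/
def swapValue (σ : ℝ) (N : ℕ) (Φ : Flow σ N) (τ : ℝ) (χ : ℝ × T3 → ℝ) (Ψ : V3 × V3 × V3 → ℝ) (r η : ℝ)
    (z : Cfg N) (k : ℕ) (ω : V3) : ℝ :=
  ∫ u, phiEta η (defect σ N τ χ Ψ r (contPath σ N Φ z k ω u)) ∂kmDice


/-! ## The swap identity (the card's first lemma, re-proved) -/

/-- The TRUE path of an abstract chronological dynamics `T k` (resolve the `k`-th contact the true way). [folklore] -/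
def truePath {S : Type*} (T : ℕ → S → S) (z : S) : ℕ → S
  | 0 => z
  | k + 1 => T k (truePath T z k)

/-- **Stein–Lindeberg (generator-comparison) identity** — the card's `stein_lindeberg_identity`, re-proved here
because the ideator's Sketch.lean is not mounted on this hub (TRIAGE-r1-1 §(i): it is `Finset.sum_range_sub`; no
dynamical content, degenerate-case safe: `M = 0` gives `0 = 0`, an ideal gas has an empty swap sum). For the
random-future value functions `U k` of the comparison chain (`U k = P k (U (k+1))`, `P k` = the fair one-step
operator, `U M = φ`), the statistic of the true path minus its comparison value at time `0` is the CHRONOLOGICAL sum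
of ONE-KICK SWAP terms `U_{k+1}(T_k z_k) − (P_k U_{k+1})(z_k)` — true past, random future. [folklore] -/
theorem stein_lindeberg_identity {S : Type*} (T : ℕ → S → S) (P : ℕ → (S → ℝ) → (S → ℝ)) (U : ℕ → S → ℝ)
    (φ : S → ℝ) (M : ℕ) (hU : ∀ k < M, U k = P k (U (k + 1))) (hM : U M = φ) (z : S) :
    φ (truePath T z M) - U 0 z =
      ∑ k ∈ Finset.range M, (U (k + 1) (T k (truePath T z k)) - P k (U (k + 1)) (truePath T z k)) :=
  calc φ (truePath T z M) - U 0 z = U M (truePath T z M) - U 0 (truePath T z 0) := by rw [hM]; rfl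
    _ = ∑ k ∈ Finset.range M, (U (k + 1) (truePath T z (k + 1)) - U k (truePath T z k)) :=
      (Finset.sum_range_sub (fun k => U k (truePath T z k)) M).symm
    _ = ∑ k ∈ Finset.range M, (U (k + 1) (T k (truePath T z k)) - P k (U (k + 1)) (truePath T z k)) :=
      Finset.sum_congr rfl fun k hk => by rw [← hU k (Finset.mem_range.1 hk)]; rfl

/-- Every kick at one contact leaves the same outgoing pair momentum (the card's `outgoing_conserved_eq`, momentum
half; = `reflectVel_fst_add_reflectVel_snd`): a kick swap carries NO conserved content — the reason the one-kick
influence of S2 is a force DIPOLE of arm `ε`, of size `O(ε/N)` and not `O(1/N)`. [folklore] -/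
theorem outgoing_momentum_eq (ω ω' : V3) (p : V3 × V3) :
    (reflectVel ω p).1 + (reflectVel ω p).2 = (reflectVel ω' p).1 + (reflectVel ω' p).2 := by
  rw [reflectVel_fst_add_reflectVel_snd, reflectVel_fst_add_reflectVel_snd]

/-- … and the same outgoing pair kinetic energy (`norm_sq_reflectVel_fst_add_norm_sq_reflectVel_snd`). [folklore] -/
theorem outgoing_energy_eq (ω ω' : V3) (p : V3 × V3) :
    ‖(reflectVel ω p).1‖ ^ 2 + ‖(reflectVel ω p).2‖ ^ 2 = ‖(reflectVel ω' p).1‖ ^ 2 + ‖(reflectVel ω' p).2‖ ^ 2 := by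
  rw [norm_sq_reflectVel_fst_add_norm_sq_reflectVel_snd, norm_sq_reflectVel_fst_add_norm_sq_reflectVel_snd]

/-! ## The four statements of the line -/

/-- **W · `Z*` is a well-posed, Gibbs-stationary Markov gas** (the CONSTRUCTION statement for the posited comparison
object; size M–L; TRIAGE-r1-2 App. C / r1-3 §A checked stationarity on paper: resampling the normal from its
conditional (admissible-flux) law given everything else is a heat-bath move on the exit-flux measure, and the specular
step maps exit flux to entry flux — `Z*` is STATIONARY, not reversible). For `σ < σ₀`, every `θe > 0`, `N`, `Φ`:
(i) the time-`t` map `(z, u) ↦ Z*_t` is measurable; (ii) the homogeneous Gibbs law `G_N = localGibbsLaw σ 1 0 θe N Φ`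
is invariant: `(G_N ⊗ kmDice) ∘ (Z*_t)⁻¹ = G_N` for `t ≥ 0`; (iii) `G_N ⊗ kmDice`-a.s. the collision instants do not
accumulate and, at every collision that happens, the incoming pair is unique and the rejection sampler finds an
admissible candidate (so `kmNormal` is a genuine draw from the restricted flux law). [folklore] -/
def KickMatchedStationary : Prop :=
  ∃ σ₀ : ℝ, 0 < σ₀ ∧ ∀ σ : ℝ, 0 < σ → σ < σ₀ → ∀ θe : ℝ, 0 < θe → ∀ (N : ℕ) (Φ : Flow σ N),
    (∀ t : ℝ, Measurable fun q : Cfg N × (ℕ → Die) => kmFlow σ N q.2 q.1 t) ∧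
    (∀ t : ℝ, 0 ≤ t →
      ((localGibbsLaw σ (fun _ => 1) (fun _ => 0) (fun _ => θe) N Φ).prod kmDice).map
          (fun q : Cfg N × (ℕ → Die) => kmFlow σ N q.2 q.1 t) =
        localGibbsLaw σ (fun _ => 1) (fun _ => 0) (fun _ => θe) N Φ) ∧
    (∀ᵐ q ∂((localGibbsLaw σ (fun _ => 1) (fun _ => 0) (fun _ => θe) N Φ).prod kmDice),
      (∀ t : ℝ, ∃ k : ℕ, ENNReal.ofReal t < Driven.instant geo (hsDiameter σ N) (kmRule σ N) q.2 q.1 k) ∧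
      (∀ k : ℕ, Driven.instant geo (hsDiameter σ N) (kmRule σ N) q.2 q.1 (k + 1) ≠ ∞ →
        let y := Driven.stateAfter geo (hsDiameter σ N) (kmRule σ N) q.2 q.1 k
        let y' := freeFlight geo (Alexander.freeExitTime geo (hsDiameter σ N) y).toReal y
        ∃ p ∈ Alexander.incomingPairs geo (hsDiameter σ N) y',
          (∀ p' ∈ Alexander.incomingPairs geo (hsDiameter σ N) y', p' = p) ∧
          ∃ n : ℕ, ‖q.2 k n‖ ≤ 1 ∧
            IsAdmissible σ N p.1 p.2
              (Lambert.lift (‖(y' p.2).2 - (y' p.1).2‖⁻¹ • ((y' p.2).2 - (y' p.1).2)) (q.2 k n)) y'))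

/-- **S1 · `FairGasContactChaos` — averaged molecular chaos at contact FOR THE COMPARISON GAS `Z*`** (size XL, open;
the Transfer's premise). The crux target's statement with the deterministic orbit replaced by the `Z*` path and the
local Gibbs law by `localGibbsLaw ⊗ kmDice`: for `σ < σ₀(profiles)`, every flow family (it only fixes the phase
space of `localGibbsLaw`), `τ, χ, Ψ, η, δ`: `∃ r₀ ∀ r < r₀ ∃ N₀ ∀ N ≥ N₀`,
`(localGibbsLaw ⊗ kmDice){(z,u) | η < |D(Z*(z,u))|} ≤ δ`. WHY EASIER than the crux target: `Z*` is a Markov gas with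
an explicit stationary law, conservative noise at EVERY contact and kicks independent given their inputs — the class
where Kac's programme / OVY–FFL local-equilibrium technology / the route's own percolation census are theorem-shaped
(none of Disproof §§2–3, F3(d) applying to the idealised network there); partner SELECTION of the deterministic gas
is never assumed anywhere in this line, it is transferred from here. Honest caveat (all three triagers): no printed
Euler-scale LE theorem covers contact-only noise at fixed density (OVY93 needs bulk exchange noise of diverging
intensity, FFL94/LO96 are lattice) — open, not a costume. [folklore] -/
def FairGasContactChaos : Prop :=
  ∀ (a₀ θ₀ : T3 → ℝ) (u₀ : T3 → V3), Continuous a₀ → Continuous θ₀ → Continuous u₀ → (∀ x, 0 < a₀ x) →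
    (∀ x, 0 < θ₀ x) → ∃ σ₀ : ℝ, 0 < σ₀ ∧ ∀ σ : ℝ, 0 < σ → σ < σ₀ → ∀ Φ : (N : ℕ) → Flow σ N,
    ∀ τ : ℝ, 0 < τ → ∀ χ : ℝ × T3 → ℝ, Continuous χ → ∀ Ψ : V3 × V3 × V3 → ℝ, Continuous Ψ →
    (∃ C : ℝ, ∀ p, |Ψ p| ≤ C) → ∀ η δ : ℝ, 0 < η → 0 < δ → ∃ r₀ : ℝ, 0 < r₀ ∧ ∀ r : ℝ, 0 < r → r < r₀ →
    ∃ N₀ : ℕ, ∀ N : ℕ, N₀ ≤ N →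
      ((localGibbsLaw σ a₀ u₀ θ₀ N (Φ N)).prod kmDice) {q | η < |starDefect σ N τ χ Ψ r q|} ≤ ENNReal.ofReal δ

/-- The (unnormalised) FLUX LAW of the impact vector of a pair with velocities `v = v_i`, `w = v_j`: density
`((w − v)·ω)₊ = hardSphereKernel (w, v) ω` on the unit sphere — the reference law of `KickIsotropyInfo`'s side condition
and the proposal law of `kmNormal`'s rejection sampler. [folklore] -/
def fluxLaw (v w : V3) : Measure (Metric.sphere (0 : V3) 1) :=
  sphereMeasure.withDensity fun ω => ENNReal.ofReal (hardSphereKernel (w, v) ω)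

/-- **The RESTRICTED reference mean** at the `k`-th collision: the average of `F` over ADMISSIBLE normals under the
flux law of the colliding pair, normalised (junk `0·…` if the admissible set is flux-null). This — and not the
unrestricted flux mean — is the one-step operator `P_k` of `Z*` (TRIAGE-r1-1 sharpen; card falsifier (d): the
unrestricted redraw mis-books the shielding stratum of weight `√2·πσ³` already in equilibrium). [folklore] -/
def restrictedMean (σ : ℝ) (N : ℕ) (Φ : Flow σ N) (z : Cfg N) (k : ℕ) (F : V3 → ℝ) : ℝ :=
  let y := preAt σ N Φ z k
  let p := pairAt σ N Φ z k
  let A : Set (Metric.sphere (0 : V3) 1) := {ω | IsAdmissible σ N p.1 p.2 (ω : V3) y}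
  let μ := fluxLaw (y p.1).2 (y p.2).2
  (μ A).toReal⁻¹ * ∫ ω in A, F (ω : V3) ∂μ

/-- **The one-kick influence** at the `k`-th collision of the orbit of `z`: the oscillation of the `Z*`-value
`swapValue` over pairs of ADMISSIBLE kicks (`0` if none is admissible — `Real.iSup` of an empty family; always `≤ 1`
since `φ_η ∈ [0, 1]` and `kmDice` is a probability law). This is `sup_ω |D_k(ω)|` up to a factor 2, `D_k` the swap
integrand with the restricted reference. [folklore] -/
def influence (σ : ℝ) (N : ℕ) (Φ : Flow σ N) (τ : ℝ) (χ : ℝ × T3 → ℝ) (Ψ : V3 × V3 × V3 → ℝ) (r η : ℝ)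
    (z : Cfg N) (k : ℕ) : ℝ :=
  ⨆ p : {p : V3 × V3 //
      IsAdmissible σ N (pairAt σ N Φ z k).1 (pairAt σ N Φ z k).2 p.1 (preAt σ N Φ z k) ∧
        IsAdmissible σ N (pairAt σ N Φ z k).1 (pairAt σ N Φ z k).2 p.2 (preAt σ N Φ z k)},
    |swapValue σ N Φ τ χ Ψ r η z k p.1.1 - swapValue σ N Φ τ χ Ψ r η z k p.1.2|

open Classical in
/-- **The `k`-th ONE-KICK SWAP INTEGRAND with the restricted reference**:
`D_k(ω) = 1_adm(ω) · (swapValue_k(ω) − restricted admissible-flux mean of swapValue_k)` — zero off the admissible set,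
hence of UNRESTRICTED flux mean zero exactly (the interface to `KickIsotropyInfo`'s side condition, the card's
`kickDefect_fluxMean_zero`), and of conditional mean zero given the full pre-collisional rest under the invariant
Gibbs law (Palm), which is the equilibrium null of the whole bookkeeping. [folklore] -/
def swapIntegrand (σ : ℝ) (N : ℕ) (Φ : Flow σ N) (τ : ℝ) (χ : ℝ × T3 → ℝ) (Ψ : V3 × V3 × V3 → ℝ) (r η : ℝ)
    (z : Cfg N) (k : ℕ) (ω : V3) : ℝ :=
  if IsAdmissible σ N (pairAt σ N Φ z k).1 (pairAt σ N Φ z k).2 ω (preAt σ N Φ z k) then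
    swapValue σ N Φ τ χ Ψ r η z k ω - restrictedMean σ N Φ z k (swapValue σ N Φ τ χ Ψ r η z k)
  else 0

/-- **The chronological swap sum** of the orbit of `z`: `Σ_{k < numColl} D_k(ω_k)` at the TRUE kicks — by
`stein_lindeberg_identity` (contact-indexed chain with clock and running record sum adjoined) its local-Gibbs mean is
EXACTLY `E φ_η(D_true) − E_{Z*} φ_η(D)` once `Z*` is well posed (STUB W) and `Φ`'s orbits are the Alexander orbits
a.e.; S3 is the statement that it is dominated by typed Kick functionals. [folklore] -/
def swapSum (σ : ℝ) (N : ℕ) (Φ : Flow σ N) (τ : ℝ) (χ : ℝ × T3 → ℝ) (Ψ : V3 × V3 × V3 → ℝ) (r η : ℝ)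
    (z : Cfg N) : ℝ :=
  ∑ k ∈ Finset.range (numColl σ N Φ τ z), swapIntegrand σ N Φ τ χ Ψ r η z k (trueKick σ N Φ z k)

/-- Off the admissible set the swap integrand vanishes (so its unrestricted flux mean is the restricted mean of a
centred function, i.e. zero). [folklore] -/
theorem swapIntegrand_of_not_admissible {σ : ℝ} {N : ℕ} {Φ : Flow σ N} {τ : ℝ} {χ : ℝ × T3 → ℝ}
    {Ψ : V3 × V3 × V3 → ℝ} {r η : ℝ} {z : Cfg N} {k : ℕ} {ω : V3}
    (h : ¬ IsAdmissible σ N (pairAt σ N Φ z k).1 (pairAt σ N Φ z k).2 ω (preAt σ N Φ z k)) :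
    swapIntegrand σ N Φ τ χ Ψ r η z k ω = 0 := by
  classical
  simp [swapIntegrand, h]

open Classical in
/-- **S2 · `OneKickInfluence` — the Stein factor, in LINDEBERG form: the total one-kick influence carried by
collisions whose influence exceeds `C·ε/(N+1)` is negligible** (size M–L; the resolvent bound:
`SpectralContractionR` — used only as a GAP, `(1 − √c)⁻¹ < 3.42`; Disproof F3's power/class correction does not bite —
bounds the tagged part `Σₙ Kⁿ F̄` of the response of the swapped spheres' future records, the partners' share is the
linearised `Z*` semigroup over `O(1)` collision times, and the hydrodynamic channel is ABSENT because a kick swap changes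
no pair momentum/energy, `outgoing_momentum_eq` / `outgoing_energy_eq`: what is swapped is a force dipole of arm `ε`,
so one swap moves the `Z*`-expected smoothed defect by `O(ε/N)` — the per-term weight of `KickIsotropyInfo` exactly —
and `N^{4/3}τ` swaps × `ε/N = O(σ³τ)`, TRIAGE-r1-1). Statement: for `σ < σ₀(profiles)`, all `Φ, τ, χ, Ψ, η, r` and
every `ϑ > 0` there are `C ≥ 0` and `N₀` with, for `N ≥ N₀`,
`E_localGibbs[ Σ_{k < numColl} influence_k · 1{influence_k > C ε/(N+1)} ] ≤ ϑ` — uniform integrability of the normalised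
influences under the collision Campbell measure (the exact analogue of Lindeberg's condition `Σ E[X_k² ; |X_k| > ε] → 0`).
What S3 consumes: off the exceptional collisions the normalised swap integrand `(N+1)/ε · D_k` is bounded by `C`, and
the exceptional ones contribute `≤ ϑ` to the swap sum in total. Why it might fail: heavy tails — rare violent states
(fast particles, dense clusters) whose one kick redirects `≫ 1` future records before the gap acts; or a conserved/slow
channel of `Z*` not cancelling (growth of the replica spread beyond ≈ 5 collision times in the card's falsifier (c)).
`swapValue` is a Bochner integral over the dice: its measurability/integrability (from W(i)) is part of this stub's
burden — were it junk (`0`), the statement would hold vacuously and be useless to S3, whose prover must then reshape. [folklore] -/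
def OneKickInfluence : Prop :=
  ∀ (a₀ θ₀ : T3 → ℝ) (u₀ : T3 → V3), Continuous a₀ → Continuous θ₀ → Continuous u₀ → (∀ x, 0 < a₀ x) →
    (∀ x, 0 < θ₀ x) → ∃ σ₀ : ℝ, 0 < σ₀ ∧ ∀ σ : ℝ, 0 < σ → σ < σ₀ → ∀ Φ : (N : ℕ) → Flow σ N,
    ∀ τ : ℝ, 0 < τ → ∀ χ : ℝ × T3 → ℝ, Continuous χ → ∀ Ψ : V3 × V3 × V3 → ℝ, Continuous Ψ →
    (∃ C : ℝ, ∀ p, |Ψ p| ≤ C) → ∀ η r ϑ : ℝ, 0 < η → 0 < r → 0 < ϑ → ∃ C : ℝ, 0 ≤ C ∧ ∃ N₀ : ℕ, ∀ N : ℕ, N₀ ≤ N →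
      ∫⁻ z, ENNReal.ofReal (∑ k ∈ Finset.range (numColl σ N (Φ N) τ z),
          if C * (hsDiameter σ N / (N + 1 : ℝ)) < influence σ N (Φ N) τ χ Ψ r η z k
          then influence σ N (Φ N) τ χ Ψ r η z k else 0)
        ∂(localGibbsLaw σ a₀ u₀ θ₀ N (Φ N)) ≤ ENNReal.ofReal ϑ

/-- **S3 · `KickAmbientDomination` — the chronological Lindeberg swap against `Z*` is dominated by the comparison
gas, by finitely many TYPED `KickIsotropyInfo` functionals with macroscopic weights `h = s_m(v, w)`, and by a
vanishing remainder** (size XL, open — the kick–ambient conspiracy functional of the card IS the remainder `δ`; this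
is the line's exposure, Boltzmann-hypothesis class with INSTANTANEOUS fine conditioning, history-free). Content of the
intended proof: (a) smoothing `1{|x| > η} ≤ φ_{η/2} ≤ 1{|x| > η/2}` and the EXACT swap identity
`E φ(D_true) − E φ(D_{Z*}) = E Σ_{k < numColl} D_k(ω_k)`, `D_k(ω) := 1_adm(ω)[swapValue_k(ω) − restricted admissible-flux
mean]` (`stein_lindeberg_identity` on the contact-indexed chain with clock and running sum adjoined; RESTRICTED
reference, TRIAGE-r1-1 sharpen); (b) a finite dictionary expansion `D_k(ω) = (ε/(N+1))[Σ_{m<m₀} a_{k,m} g_m(ω, v_k, w_k)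
+ R_k]` with `g_m` continuous, bounded, flux-mean-zero — `g_m = c(v,w)·(p_m(ω) − p̄_m(v,w))`, polynomial `p_m`, cutoff
`c` vanishing at `v = w` (TRIAGE-r1-3 sharpen) — and coefficients `|a_{k,m}| ≤ C` off the `ϑ`-weight exceptional
collisions of `OneKickInfluence` (where `|D_k| ≤ 2` since `φ ∈ [0,1]`); (c) the split
`E[a_{k,m} g_m(ω_k)] = E[a_{k,m} ḡ_{k,m}] + E[a_{k,m}(g_m(ω_k) − ḡ_{k,m})]`, `ḡ_{k,m} := E[g_m(ω_k) | v_k, w_k]`, whose first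
part is `≤ C · E[(ε/(N+1)) Σ_k s_m(v_k,w_k) g_m(ω_k)]`, `s_m = sign ḡ_{k,m}(·,·)` measurable with `|s_m| ≤ 1` — a
`kickFunctional` with the weight `velWeight s_m` after the ordered-record double count; (d) THE CONSPIRACY:
`Σ_m Σ_k (ε/(N+1)) E[a_{k,m}(g_m(ω_k) − ḡ_{k,m})] + Σ_k (ε/(N+1)) E[R_k(ω_k)] → 0` AS A WHOLE (never harmonic by harmonic:
card falsifier (d)) — identically `0` under the invariant Gibbs law for this LINEAR-in-`B` bookkeeping (Palm: given the
full pre-collisional rest, `ω_k` is admissible-flux distributed, so `E[D_k(ω_k) | rest] = 0`, and `ḡ ≡ 0` by isotropy),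
carried out of equilibrium by instantaneous 3-clusters at scale `Aε` (weight `πσ³`), attacked by the card's Maxwellian
bootstrap, honest floor `O(σ³/A)`. Conditioning on `(v, w)` only: adding the `r`-cell fields `F_r` of the card changes
(c)+(d) by `≤ C(E|ḡ^{vw}| + E|ḡ^{vwF}|)`, a Kick-small amount. [folklore] -/
def KickAmbientDomination : Prop :=
  ∀ (a₀ θ₀ : T3 → ℝ) (u₀ : T3 → V3), Continuous a₀ → Continuous θ₀ → Continuous u₀ → (∀ x, 0 < a₀ x) →
    (∀ x, 0 < θ₀ x) → ∃ σ₀ : ℝ, 0 < σ₀ ∧ ∀ σ : ℝ, 0 < σ → σ < σ₀ → ∀ Φ : (N : ℕ) → Flow σ N,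
    ∀ τ : ℝ, 0 < τ → ∀ χ : ℝ × T3 → ℝ, Continuous χ → ∀ Ψ : V3 × V3 × V3 → ℝ, Continuous Ψ →
    (∃ C : ℝ, ∀ p, |Ψ p| ≤ C) → ∀ η δ r : ℝ, 0 < η → 0 < δ → 0 < r →
    ∃ m₀ : ℕ, ∃ g : Fin m₀ → (V3 × V3 × V3 → ℝ), (∀ m, Continuous (g m)) ∧ (∀ m, ∃ C : ℝ, ∀ p, |g m p| ≤ C) ∧
      (∀ m, IsFluxMeanZero (g m)) ∧ ∃ C : ℝ, 0 ≤ C ∧ ∃ N₀ : ℕ, ∀ N : ℕ, N₀ ≤ N →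
      ∃ s : Fin m₀ → (V3 × V3 → ℝ), (∀ m, Measurable (s m)) ∧ (∀ m p, |s m p| ≤ 1) ∧
        localGibbsLaw σ a₀ u₀ θ₀ N (Φ N) {z | η < |trueDefect σ N (Φ N) τ χ Ψ r z|} ≤
          ((localGibbsLaw σ a₀ u₀ θ₀ N (Φ N)).prod kmDice) {q | η / 2 < |starDefect σ N τ χ Ψ r q|} +
            ENNReal.ofReal δ +
            ENNReal.ofReal C * ∑ m : Fin m₀, ∫⁻ z, ENNReal.ofReal
              |kickFunctional σ N (Φ N) τ r (g m) (velWeight N (s m)) z| ∂(localGibbsLaw σ a₀ u₀ θ₀ N (Φ N))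

/-! ## Reshaped stubs (line lead, 2026-08-16): W = W1 ∧ W2 and S3 = S3a ∧ S3b, with proved glue

The lead's reshape keeps the planner's four statements W, S1, S2, S3 and the composition through them verbatim, and
refines the two composite ones at the skeleton level (D-0019: total 6 ≤ `stubs_max` = 7 registered stubs, two layers):
* W  = `KickMatchedStationary` ⇐ W1 `KickMatchedMeasurable` (clause (i), pure measurability of the `Driven` recursion
  with the measurable rule `kmRule` — provable now on the template of `Alexander.torusFlow_measurable_holds`) ∧ W2
  `KickMatchedStationaryCore` (clauses (ii)–(iii): Gibbs-stationarity and a.s. well-posedness — the analytic part, on the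
  template of `torusFlow_measurePreserving_holds` / `torusFlow_ae_good_holds`); glue `kickMatchedStationary_of`.
* S3 = `KickAmbientDomination` ⇐ S3a `SwapIdentity` (the EXACT chronological swap identity
  `E φ_η(D_true) = E φ_η(D_{Z*}) + E swapSum_η` with the measurability / integrability it needs — strong Markov property of
  `Z*` at contacts (`Driven.stateAfter_succ'`), the law of `kmNormal` = normalised restricted flux law (Lambert lift +
  rejection sampling), Fubini over `kmDice ≅ Die ⊗ kmDice`; NO limit, NO dynamics estimate: size L, provable after W) ∧ S3b
  `SwapSumDomination` (the conspiracy proper: `|E swapSum_η| ≤ δ + C Σ_m ‖kickFunctional (g m) (velWeight (s m))‖_{L¹}` —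
  the line's open content, held by the lead); glue `kickAmbientDomination_of` (smoothing sandwich
  `1{η < |x|} ≤ φ_{η/2}(x) ≤ 1{η/2 < |x|}` + two Markov steps, PROVED below).
Why S3a is exactly true on good orbits: the hybrids "first m contacts resolved truly, `Z*` afterwards" interpolate between
`Z*` (m = 0) and the true orbit (m = numColl: after the last true collision in `(0, τ]` the `Z*` continuation shares the
free flight, so its next contact is the orbit's, `> τ`, and `defect` only reads the path on `[0, τ]`); consecutive hybrids
differ by `swapValue_m(ω_m) − E_die swapValue_m(kmNormal)` = `swapIntegrand_m(ω_m)` because the true kick is admissible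
(`kickAt` with `ω = trueKick` re-places the partner where it is: `translate x_i (−ε·ε⁻¹ sepVec x_i x_j) = x_j`) and, off
triple contacts (Liouville-null), the admissible set has positive flux measure so the sampler's law is the restricted
flux law; the sum telescopes PATHWISE, so `|swapSum| ≤ 1` wherever the identity holds (integrability is not an extra
assumption on `numColl`). -/

/-- **W1 · `KickMatchedMeasurable`** — clause (i) of `KickMatchedStationary`, for every `0 < σ < 1/2` (so that the
diameter `hsDiameter σ N ≤ σ < 1/2` keeps the torus geometry hard-sphere regular, `Torus.isHardSphereRegular_geometry`),
every `N` and `t`: the time-`t` map `(z, u) ↦ Z*_t(z; u) = kmFlow σ N u z t` is jointly measurable. By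
`Driven.measurable_flow` (StochasticCollisionHardSphereProcess) this is exactly `Driven.MeasurableRule (kmRule σ N)`:
`kickAt` is measurable (`Torus.isMeasurable_geometry`, `measurable_collidePair`, `Function.update`) and `kmNormal` is a
`Nat.find` over the measurable predicates `‖d n‖ ≤ 1 ∧ IsAdmissible … (Lambert.lift a (d n)) y`. [folklore] -/
def KickMatchedMeasurable : Prop :=
  ∀ σ : ℝ, 0 < σ → σ < 1 / 2 → ∀ (N : ℕ) (t : ℝ), Measurable fun q : Cfg N × (ℕ → Die) => kmFlow σ N q.2 q.1 t

/-- **W2 · `KickMatchedStationaryCore`** — clauses (ii)–(iii) of `KickMatchedStationary` (verbatim): for `σ < σ₀`,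
every `θe > 0`, `N`, `Φ`, the homogeneous Gibbs law `G_N = localGibbsLaw σ 1 0 θe N Φ` is invariant under `Z*_t`,
`t ≥ 0` (heat-bath resampling of the normal on the exit-flux measure, then specular exit → entry), and `G_N ⊗ kmDice`-a.s.
the instants do not accumulate, the incoming pair of every collision is unique and the rejection sampler finds an
admissible candidate. [folklore] -/
def KickMatchedStationaryCore : Prop :=
  ∃ σ₀ : ℝ, 0 < σ₀ ∧ ∀ σ : ℝ, 0 < σ → σ < σ₀ → ∀ θe : ℝ, 0 < θe → ∀ (N : ℕ) (Φ : Flow σ N),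
    (∀ t : ℝ, 0 ≤ t →
      ((localGibbsLaw σ (fun _ => 1) (fun _ => 0) (fun _ => θe) N Φ).prod kmDice).map
          (fun q : Cfg N × (ℕ → Die) => kmFlow σ N q.2 q.1 t) =
        localGibbsLaw σ (fun _ => 1) (fun _ => 0) (fun _ => θe) N Φ) ∧
    (∀ᵐ q ∂((localGibbsLaw σ (fun _ => 1) (fun _ => 0) (fun _ => θe) N Φ).prod kmDice),
      (∀ t : ℝ, ∃ k : ℕ, ENNReal.ofReal t < Driven.instant geo (hsDiameter σ N) (kmRule σ N) q.2 q.1 k) ∧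
      (∀ k : ℕ, Driven.instant geo (hsDiameter σ N) (kmRule σ N) q.2 q.1 (k + 1) ≠ ∞ →
        let y := Driven.stateAfter geo (hsDiameter σ N) (kmRule σ N) q.2 q.1 k
        let y' := freeFlight geo (Alexander.freeExitTime geo (hsDiameter σ N) y).toReal y
        ∃ p ∈ Alexander.incomingPairs geo (hsDiameter σ N) y',
          (∀ p' ∈ Alexander.incomingPairs geo (hsDiameter σ N) y', p' = p) ∧
          ∃ n : ℕ, ‖q.2 k n‖ ≤ 1 ∧
            IsAdmissible σ N p.1 p.2
              (Lambert.lift (‖(y' p.2).2 - (y' p.1).2‖⁻¹ • ((y' p.2).2 - (y' p.1).2)) (q.2 k n)) y'))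

/-- Glue W1 ∧ W2 ⇒ W. [folklore] -/
theorem kickMatchedStationary_of (h1 : KickMatchedMeasurable) (h2 : KickMatchedStationaryCore) :
    KickMatchedStationary := by
  obtain ⟨σ₀, hσ₀, H⟩ := h2
  refine ⟨min (1 / 2) σ₀, lt_min one_half_pos hσ₀, fun σ hσ hσlt θe hθe N Φ => ⟨fun t => ?_, ?_⟩⟩
  · exact h1 σ hσ (lt_of_lt_of_le hσlt (min_le_left _ _)) N t
  · exact H σ hσ (lt_of_lt_of_le hσlt (min_le_right _ _)) θe hθe N Φ

/-- **S3a · `SwapIdentity` — the exact chronological Stein–Lindeberg swap identity for the gas, with its measure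
theory.** For `σ < σ₀(profiles)`, every `Φ, τ, χ, Ψ, η, r, N`: the true and the `Z*` defects are a.e.-strongly
measurable under their laws, the swap sum `swapSum … η` is integrable under the local Gibbs law, and
`∫ φ_η(D_true) dlG = ∫ φ_η(D_{Z*}) d(lG ⊗ kmDice) + ∫ swapSum_η dlG` (`stein_lindeberg_identity` on the contact-indexed
hybrids; see the section docstring for why it is exactly true on good orbits; `|swapSum| ≤ 1` a.e. comes with it).
No limit, no estimate on the dynamics: size L, provable after W. [folklore] -/
def SwapIdentity : Prop :=
  ∀ (a₀ θ₀ : T3 → ℝ) (u₀ : T3 → V3), Continuous a₀ → Continuous θ₀ → Continuous u₀ → (∀ x, 0 < a₀ x) →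
    (∀ x, 0 < θ₀ x) → ∃ σ₀ : ℝ, 0 < σ₀ ∧ ∀ σ : ℝ, 0 < σ → σ < σ₀ → ∀ Φ : (N : ℕ) → Flow σ N,
    ∀ τ : ℝ, 0 < τ → ∀ χ : ℝ × T3 → ℝ, Continuous χ → ∀ Ψ : V3 × V3 × V3 → ℝ, Continuous Ψ →
    (∃ C : ℝ, ∀ p, |Ψ p| ≤ C) → ∀ η r : ℝ, 0 < η → 0 < r → ∀ N : ℕ,
      AEStronglyMeasurable (trueDefect σ N (Φ N) τ χ Ψ r) (localGibbsLaw σ a₀ u₀ θ₀ N (Φ N)) ∧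
      AEStronglyMeasurable (starDefect σ N τ χ Ψ r) ((localGibbsLaw σ a₀ u₀ θ₀ N (Φ N)).prod kmDice) ∧
      Integrable (swapSum σ N (Φ N) τ χ Ψ r η) (localGibbsLaw σ a₀ u₀ θ₀ N (Φ N)) ∧
      ∫ z, phiEta η (trueDefect σ N (Φ N) τ χ Ψ r z) ∂(localGibbsLaw σ a₀ u₀ θ₀ N (Φ N)) =
        ∫ q, phiEta η (starDefect σ N τ χ Ψ r q) ∂((localGibbsLaw σ a₀ u₀ θ₀ N (Φ N)).prod kmDice) +
          ∫ z, swapSum σ N (Φ N) τ χ Ψ r η z ∂(localGibbsLaw σ a₀ u₀ θ₀ N (Φ N))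

/-- **S3b · `SwapSumDomination` — the kick–ambient conspiracy (the line's open content, HARDEST; held by the lead).**
For `σ < σ₀(profiles)`, every `Φ, τ, χ, Ψ` and `η, δ, r > 0` there are a finite dictionary `g_m` (`m < m₀`) of
continuous bounded flux-mean-zero kick tests and `C ≥ 0`, `N₀` such that for `N ≥ N₀` some measurable velocity weights
`|s_m| ≤ 1` give `|∫ swapSum_η dlG| ≤ δ + C Σ_m ‖kickFunctional (g m) (velWeight (s m))‖_{L¹(lG)}` (in `ℝ≥0∞`). Content
= steps (b)–(d) of the planner's S3 docstring: dictionary expansion of `D_k`, the `(v, w)`-conditional split paying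
typed `KickIsotropyInfo` with `s_m = sign ḡ_{k,m}`, and THE CONSPIRACY `→ 0` (identically `0` under the invariant Gibbs
law by Palm with the restricted reference; out of equilibrium carried by instantaneous 3-clusters at scale `Aε`).
[folklore] -/
def SwapSumDomination : Prop :=
  ∀ (a₀ θ₀ : T3 → ℝ) (u₀ : T3 → V3), Continuous a₀ → Continuous θ₀ → Continuous u₀ → (∀ x, 0 < a₀ x) →
    (∀ x, 0 < θ₀ x) → ∃ σ₀ : ℝ, 0 < σ₀ ∧ ∀ σ : ℝ, 0 < σ → σ < σ₀ → ∀ Φ : (N : ℕ) → Flow σ N,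
    ∀ τ : ℝ, 0 < τ → ∀ χ : ℝ × T3 → ℝ, Continuous χ → ∀ Ψ : V3 × V3 × V3 → ℝ, Continuous Ψ →
    (∃ C : ℝ, ∀ p, |Ψ p| ≤ C) → ∀ η δ r : ℝ, 0 < η → 0 < δ → 0 < r →
    ∃ m₀ : ℕ, ∃ g : Fin m₀ → (V3 × V3 × V3 → ℝ), (∀ m, Continuous (g m)) ∧ (∀ m, ∃ C : ℝ, ∀ p, |g m p| ≤ C) ∧
      (∀ m, IsFluxMeanZero (g m)) ∧ ∃ C : ℝ, 0 ≤ C ∧ ∃ N₀ : ℕ, ∀ N : ℕ, N₀ ≤ N →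
      ∃ s : Fin m₀ → (V3 × V3 → ℝ), (∀ m, Measurable (s m)) ∧ (∀ m p, |s m p| ≤ 1) ∧
        ENNReal.ofReal |∫ z, swapSum σ N (Φ N) τ χ Ψ r η z ∂(localGibbsLaw σ a₀ u₀ θ₀ N (Φ N))| ≤
          ENNReal.ofReal δ +
            ENNReal.ofReal C * ∑ m : Fin m₀, ∫⁻ z, ENNReal.ofReal
              |kickFunctional σ N (Φ N) τ r (g m) (velWeight N (s m)) z| ∂(localGibbsLaw σ a₀ u₀ θ₀ N (Φ N))

/-! ### The smoothing sandwich and the glue S3a ∧ S3b ⇒ S3 (proved) -/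

/-- `φ_η ≥ 0`. [folklore] -/
theorem phiEta_nonneg (η x : ℝ) (hη : 0 ≤ η) : 0 ≤ phiEta η x :=
  le_min zero_le_one (div_nonneg (le_max_right _ _) hη)

/-- `φ_η ≤ 1`. [folklore] -/
theorem phiEta_le_one (η x : ℝ) : phiEta η x ≤ 1 := min_le_left _ _

/-- `φ_η(x) = 0` for `|x| ≤ η`. [folklore] -/
theorem phiEta_eq_zero {η x : ℝ} (h : |x| ≤ η) : phiEta η x = 0 := by
  have : max (|x| - η) 0 = 0 := max_eq_right (by linarith)
  simp [phiEta, this]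

/-- `φ_η(x) = 1` for `2η ≤ |x|`, `η > 0`. [folklore] -/
theorem phiEta_eq_one {η x : ℝ} (hη : 0 < η) (h : 2 * η ≤ |x|) : phiEta η x = 1 := by
  unfold phiEta
  refine min_eq_left ?_
  rw [le_div_iff₀ hη, one_mul]
  exact le_trans (by linarith) (le_max_left _ _)

/-- `φ_η` is continuous. [folklore] -/
theorem continuous_phiEta (η : ℝ) : Continuous (phiEta η) := by
  unfold phiEta
  fun_prop

/-- Lower Markov step: `μ{η < |F|} ≤ ofReal (∫ φ_{η/2} ∘ F dμ)` for an a.e.-strongly measurable `F` on a finite measure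
space. [folklore] -/
theorem measure_lt_abs_le_ofReal_integral_phiEta {α : Type*} [MeasurableSpace α] {μ : Measure α}
    [IsFiniteMeasure μ] {F : α → ℝ} (hF : AEStronglyMeasurable F μ) {η : ℝ} (hη : 0 < η) :
    μ {a | η < |F a|} ≤ ENNReal.ofReal (∫ a, phiEta (η / 2) (F a) ∂μ) := by
  have hint : Integrable (fun a => phiEta (η / 2) (F a)) μ := by
    refine Integrable.of_bound ((continuous_phiEta _).comp_aestronglyMeasurable hF) 1 ?_
    exact Filter.Eventually.of_forall fun a => by
      rw [Real.norm_eq_abs, abs_of_nonneg (phiEta_nonneg _ _ (by positivity))]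
      exact phiEta_le_one _ _
  rw [ofReal_integral_eq_lintegral_ofReal hint
    (Filter.Eventually.of_forall fun a => phiEta_nonneg _ _ (by positivity))]
  have hS : NullMeasurableSet {a | η < |F a|} μ :=
    (continuous_abs.measurable.comp_aemeasurable hF.aemeasurable).nullMeasurableSet_preimage measurableSet_Ioi
  calc μ {a | η < |F a|} = ∫⁻ a, {a | η < |F a|}.indicator 1 a ∂μ := (lintegral_indicator_one₀ hS).symm
    _ ≤ ∫⁻ a, ENNReal.ofReal (phiEta (η / 2) (F a)) ∂μ := by
        refine lintegral_mono fun a => ?_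
        by_cases ha : a ∈ {a | η < |F a|}
        · rw [Set.indicator_of_mem ha, Pi.one_apply, phiEta_eq_one (by positivity) (by
            have : η < |F a| := ha; linarith), ENNReal.ofReal_one]
        · rw [Set.indicator_of_notMem ha]
          exact bot_le

/-- Upper Markov step: `ofReal (∫ φ_η ∘ F dμ) ≤ μ{η < |F|}`. [folklore] -/
theorem ofReal_integral_phiEta_le_measure {α : Type*} [MeasurableSpace α] {μ : Measure α}
    [IsFiniteMeasure μ] {F : α → ℝ} (hF : AEStronglyMeasurable F μ) {η : ℝ} (hη : 0 < η) :
    ENNReal.ofReal (∫ a, phiEta η (F a) ∂μ) ≤ μ {a | η < |F a|} := by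
  have hint : Integrable (fun a => phiEta η (F a)) μ := by
    refine Integrable.of_bound ((continuous_phiEta _).comp_aestronglyMeasurable hF) 1 ?_
    exact Filter.Eventually.of_forall fun a => by
      rw [Real.norm_eq_abs, abs_of_nonneg (phiEta_nonneg _ _ hη.le)]
      exact phiEta_le_one _ _
  rw [ofReal_integral_eq_lintegral_ofReal hint (Filter.Eventually.of_forall fun a => phiEta_nonneg _ _ hη.le)]
  have hS : NullMeasurableSet {a | η < |F a|} μ :=
    (continuous_abs.measurable.comp_aemeasurable hF.aemeasurable).nullMeasurableSet_preimage measurableSet_Ioi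
  calc ∫⁻ a, ENNReal.ofReal (phiEta η (F a)) ∂μ ≤ ∫⁻ a, {a | η < |F a|}.indicator 1 a ∂μ := by
        refine lintegral_mono fun a => ?_
        by_cases ha : a ∈ {a | η < |F a|}
        · rw [Set.indicator_of_mem ha, Pi.one_apply]
          exact ENNReal.ofReal_le_one.2 (phiEta_le_one _ _)
        · rw [Set.indicator_of_notMem ha, phiEta_eq_zero (by have : ¬ η < |F a| := ha; linarith),
            ENNReal.ofReal_zero]
    _ = μ {a | η < |F a|} := lintegral_indicator_one₀ hS

/-- **Glue S3a ∧ S3b ⇒ S3.** `lG{η < |D|} ≤ ofReal ∫φ_{η/2}(D) = ofReal (∫φ_{η/2}(D*) + ∫swapSum) ≤ P*{η/2 < |D*|} +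
ofReal |∫ swapSum| ≤ P*{…} + δ + C Σ Kick`; thresholds `σ₀ := min (1/2) (min σa σb)` (`1/2` makes the local Gibbs law a
probability measure, `isProbabilityMeasure_localGibbsLaw`). [folklore] -/
theorem kickAmbientDomination_of (hI : SwapIdentity) (hD : SwapSumDomination) : KickAmbientDomination := by
  intro a₀ θ₀ u₀ ha hθ hu ha0 hθ0
  obtain ⟨σI, hσI, HI⟩ := hI a₀ θ₀ u₀ ha hθ hu ha0 hθ0
  obtain ⟨σD, hσD, HD⟩ := hD a₀ θ₀ u₀ ha hθ hu ha0 hθ0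
  refine ⟨min (1 / 2) (min σI σD), lt_min one_half_pos (lt_min hσI hσD),
    fun σ hσ hσlt Φ τ hτ χ hχ Ψ hΨ hΨb η δ r hη hδ hr => ?_⟩
  have hσ2 : σ ≤ 1 / 2 := (lt_of_lt_of_le hσlt (min_le_left _ _)).le
  have hltI : σ < σI := lt_of_lt_of_le hσlt ((min_le_right _ _).trans (min_le_left _ _))
  have hltD : σ < σD := lt_of_lt_of_le hσlt ((min_le_right _ _).trans (min_le_right _ _))
  obtain ⟨m₀, g, hgc, hgb, hgf, C, hC, N₀, HDN⟩ :=
    HD σ hσ hltD Φ τ hτ χ hχ Ψ hΨ hΨb (η / 2) δ r (by positivity) hδ hr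
  refine ⟨m₀, g, hgc, hgb, hgf, C, hC, N₀, fun N hN => ?_⟩
  obtain ⟨s, hsm, hsb, Hdom⟩ := HDN N hN
  refine ⟨s, hsm, hsb, ?_⟩
  obtain ⟨hmT, hmS, _hint, hid⟩ := HI σ hσ hltI Φ τ hτ χ hχ Ψ hΨ hΨb (η / 2) r (by positivity) hr N
  haveI : IsProbabilityMeasure (localGibbsLaw σ a₀ u₀ θ₀ N (Φ N)) :=
    isProbabilityMeasure_localGibbsLaw ha hθ hu ha0 hθ0 hσ2 N (Φ N)
  calc localGibbsLaw σ a₀ u₀ θ₀ N (Φ N) {z | η < |trueDefect σ N (Φ N) τ χ Ψ r z|}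
      ≤ ENNReal.ofReal (∫ z, phiEta (η / 2) (trueDefect σ N (Φ N) τ χ Ψ r z) ∂(localGibbsLaw σ a₀ u₀ θ₀ N (Φ N))) :=
        measure_lt_abs_le_ofReal_integral_phiEta hmT hη
    _ = ENNReal.ofReal (∫ q, phiEta (η / 2) (starDefect σ N τ χ Ψ r q) ∂((localGibbsLaw σ a₀ u₀ θ₀ N (Φ N)).prod kmDice) +
          ∫ z, swapSum σ N (Φ N) τ χ Ψ r (η / 2) z ∂(localGibbsLaw σ a₀ u₀ θ₀ N (Φ N))) := by rw [hid]
    _ ≤ ENNReal.ofReal (∫ q, phiEta (η / 2) (starDefect σ N τ χ Ψ r q) ∂((localGibbsLaw σ a₀ u₀ θ₀ N (Φ N)).prod kmDice)) +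
          ENNReal.ofReal |∫ z, swapSum σ N (Φ N) τ χ Ψ r (η / 2) z ∂(localGibbsLaw σ a₀ u₀ θ₀ N (Φ N))| :=
        ENNReal.ofReal_add_le.trans (add_le_add le_rfl (ENNReal.ofReal_le_ofReal (le_abs_self _)))
    _ ≤ ((localGibbsLaw σ a₀ u₀ θ₀ N (Φ N)).prod kmDice) {q | η / 2 < |starDefect σ N τ χ Ψ r q|} +
          (ENNReal.ofReal δ + ENNReal.ofReal C * ∑ m : Fin m₀, ∫⁻ z, ENNReal.ofReal
              |kickFunctional σ N (Φ N) τ r (g m) (velWeight N (s m)) z| ∂(localGibbsLaw σ a₀ u₀ θ₀ N (Φ N))) :=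
        add_le_add (ofReal_integral_phiEta_le_measure hmS (by positivity)) Hdom
    _ = _ := (add_assoc _ _ _).symm

/-! ## Registered stubs (the only `sorry`s of the file): W1, W2, S1, S2, S3a, S3b -/

/-- The statement of `stub_kickMatchedMeasurable` (W1). [folklore] -/
def Stubs.stub_kickMatchedMeasurable : Prop := KickMatchedMeasurable

/-- The statement of `stub_kickMatchedStationaryCore` (W2). [folklore] -/
def Stubs.stub_kickMatchedStationaryCore : Prop := KickMatchedStationaryCore

/-- The statement of `stub_fairGasContactChaos` (S1). [folklore] -/
def Stubs.stub_fairGasContactChaos : Prop := KickMatchedStationary → FairGasContactChaos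

/-- The statement of `stub_oneKickInfluence` (S2). [folklore] -/
def Stubs.stub_oneKickInfluence : Prop := SpectralContractionR → KickMatchedStationary → OneKickInfluence

/-- The statement of `stub_swapIdentity` (S3a). [folklore] -/
def Stubs.stub_swapIdentity : Prop := KickMatchedStationary → SwapIdentity

/-- The statement of `stub_swapSumDomination` (S3b). [folklore] -/
def Stubs.stub_swapSumDomination : Prop := KickMatchedStationary → OneKickInfluence → SwapSumDomination

/-- STUB W1 (size S–M, provable now): joint measurability of `Z*_t`. Leans on: `Driven.measurable_flow`
(StochasticCollisionHardSphereProcess: needs `Torus.isHardSphereRegular_geometry (hsDiameter σ N < 2⁻¹)`,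
`Torus.isMeasurable_geometry`, `Driven.MeasurableRule (kmRule σ N)`), `Geometry.IsMeasurable.measurable_collidePair`,
measurability of `Lambert.lift` (piecewise-continuous frame `Lambert.e₁/e₂`), `Nat.find` over the measurable predicates
`‖d n‖ ≤ 1 ∧ IsAdmissible …` (`measurableSet_hardSphereDomain`, `measurableSet_lt`). -/
theorem stub_kickMatchedMeasurable : KickMatchedMeasurable := by
  sorry

/-- STUB W2 (size M–L): Gibbs-stationarity and a.s. well-posedness of `Z*`. Leans on: W1, `Driven.*`, `KernelGas.dice`
(`Measure.infinitePi`), `Alexander.freeExitTime/incomingPairs`, the window-iteration scheme of `HardSphereAlexander`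
(`torusFlow_ae_good_holds`, `torusFlow_measurePreserving_holds`, `HardSphereShortTime`, `HardSphereScattering`),
`Lambert.lift/norm_lift/inner_lift_self`, `measurePreserving_freeFlight_torus`, `canonicalDensity`,
`localGibbsLaw_eq`, `isProbabilityMeasure_localGibbsLaw`; print CometsEtAl2008 Thm 2.4, CookFeres2012 Thm 1 / Prop 8,
CIP1994 App. 4.A. -/
theorem stub_kickMatchedStationaryCore : KickMatchedStationaryCore := by
  sorry

/-- W from W1 ∧ W2 (no `sorry` of its own). [folklore] -/
theorem kickMatchedStationary_holds : KickMatchedStationary :=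
  kickMatchedStationary_of stub_kickMatchedMeasurable stub_kickMatchedStationaryCore

/-- STUB S1 (size XL, open): contact chaos for the kick-matched Markov gas. Leans on: W, the route's census
vocabulary if proved by percolation ON `Z*` (`IsDagEdge`, `dagPaths`, `pathPairCount`,
`Literature.Probability.Entropy.PolyanskiyWu2017_thm5(_chiSq)` with INPUT-RESTRICTED coefficients and the invariant
sector carried exactly — Disproof F3(c′,d)), or Kac / relative-entropy technology (`TaggedSphereSpectralGap.
exists_spectralGap`, `KipnisLandim1999_A1_8_2_holds`); print: OllaVaradhanYau1993, FritzFunakiLebowitz1994,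
Rezakhanlou2003, LampisPetrina (acq-04586), CarlenCarvalhoLoss (doi:10.1007/bf02392695). -/
theorem stub_fairGasContactChaos : KickMatchedStationary → FairGasContactChaos := by
  sorry

/-- STUB S2 (size M–L): the Stein factor from the gap. Leans on: `SpectralContractionR` (route crux 3, numerically
true, c = λ₂² ≈ 0.219; any gap suffices), `TaggedSphereDiffusion.linearBoltzmannOp` / `exists_spectralGap`,
`outgoing_momentum_eq`, `outgoing_energy_eq`, W (stationarity ⇒ the linearised `Z*` semigroup is a contraction
with a gap on non-conserved one-body content); print: BarangerMouhot (doi:10.4171/rmi/424), doi:10.3934/krm.2008.1.521,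
Chatterjee2006 (Lindeberg influences), Barbour1990 (Stein factors). -/
theorem stub_oneKickInfluence : SpectralContractionR → KickMatchedStationary → OneKickInfluence := by
  sorry

/-- STUB S3a (size L, provable after W): the exact swap identity with its measure theory. Leans on:
`stein_lindeberg_identity`, `Driven.stateAfter_succ'` (restart), `KernelGas.dice` product structure, W (a.s. unique
incoming pair, terminating sampler, no accumulation; measurability), `IsHardSphereTrajectory.*` for the orbit
(`locFinite`, `binary`, `eq_collidePair_leftLim`, `contactPairs_eq_pair`), Lambert's cosine law for `Lambert.lift`
(DicedHardSphereDynamics), Fubini (`MeasureTheory.integral_prod`). -/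
theorem stub_swapIdentity : KickMatchedStationary → SwapIdentity := by
  sorry

/-- STUB S3b (size XL, open — HARDEST, the lead's): the kick–ambient conspiracy. Leans on: S3a's vocabulary, W, S2
(`OneKickInfluence`: off the exceptional collisions `(N+1)/ε · D_k` is bounded by `C`), `HardSphereFlow.coarsePastOf/
nthRecordOf` + `HardSphereCollisionRecordMeasurable` (record ↔ chronological collision, `velWeight`),
`MeasureTheory.condExp` (for `ḡ`), Stone–Weierstrass on `S²`, `RecollisionGeometry` (3-cluster census); print:
Chatterjee2006, MischlerMouhot2012, Soto2016 p.126, Cohen1967. -/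
theorem stub_swapSumDomination : KickMatchedStationary → OneKickInfluence → SwapSumDomination := by
  sorry

/-- S3 from S3a ∧ S3b (no `sorry` of its own). [folklore] -/
theorem kickAmbientDomination_holds : KickMatchedStationary → OneKickInfluence → KickAmbientDomination :=
  fun hW hO => kickAmbientDomination_of (stub_swapIdentity hW) (stub_swapSumDomination hW hO)

/-! ## The composition: W, S1, S2, S3, `KickIsotropyInfo` and `SpectralContractionR` give the crux BY NAME -/

/-- Real-arithmetic heart of the threshold bookkeeping: with `δK = δ/(3(C+1)(m₀+1))`,
`δ/3 + δ/3 + C·(m₀·δK) ≤ δ`. [folklore] -/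
theorem budget_le {δ C : ℝ} (hδ : 0 ≤ δ) (hC : 0 ≤ C) (m₀ : ℕ) :
    δ / 3 + δ / 3 + C * ((m₀ : ℝ) * (δ / (3 * (C + 1) * ((m₀ : ℝ) + 1)))) ≤ δ := by
  have hm : (0 : ℝ) ≤ m₀ := Nat.cast_nonneg _
  have hden : 0 < 3 * (C + 1) * ((m₀ : ℝ) + 1) := by positivity
  have key : C * ((m₀ : ℝ) * (δ / (3 * (C + 1) * ((m₀ : ℝ) + 1)))) ≤ δ / 3 := by
    rw [show C * ((m₀ : ℝ) * (δ / (3 * (C + 1) * ((m₀ : ℝ) + 1)))) =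
        (C * m₀) / ((C + 1) * ((m₀ : ℝ) + 1)) * (δ / 3) by field_simp]
    have h1 : (C * m₀) / ((C + 1) * ((m₀ : ℝ) + 1)) ≤ 1 := by
      rw [div_le_one (by positivity)]
      nlinarith
    calc (C * m₀) / ((C + 1) * ((m₀ : ℝ) + 1)) * (δ / 3) ≤ 1 * (δ / 3) := by gcongr
      _ = δ / 3 := one_mul _
  linarith

/-- **`PercolationClosesChaos` from the four line statements W, S1, S2, S3** (the planner's composition, kept verbatim as the
inner step of `PercolationClosesChaos_of`). Kernel-checked bookkeeping: unfold the
crux target and crux 2 through the `Iff.rfl` bridges; `σ₀ := min σ₁ (min σ₃ σK)` from S1, S3 and `KickIsotropyInfo`;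
S1 at `(η/2, δ/3)` supplies `r₀` and kills the comparison-gas term; S3 at `(η, δ/3, r)` supplies the dictionary
`g_m`, the constant `C` and, for each `N`, the macroscopic weights `s_m(v, w)`; `KickIsotropyInfo` at scale `r` with
the TYPED weights `velWeight (s m)` (measurable, `|·| ≤ 1`) and accuracy `δK = δ/(3(C+1)(m₀+1))`, uniformly in the
weights — so that `s` may depend on `N` — kills each `kickFunctional`; `N₀ := max N₁ (max N₃ (sup NK))`;
`budget_le`. `SpectralContractionR` enters through S2 only (as a gap). [folklore] -/
theorem PercolationClosesChaos_of₄ (hW : KickMatchedStationary) (hS1 : KickMatchedStationary → FairGasContactChaos)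
    (hS2 : SpectralContractionR → KickMatchedStationary → OneKickInfluence)
    (hS3 : KickMatchedStationary → OneKickInfluence → KickAmbientDomination) :
    PercolationClosesChaos := by
  intro hKick hSpec
  have h1 : FairGasContactChaos := hS1 hW
  have h3 : KickAmbientDomination := hS3 hW (hS2 hSpec hW)
  rw [kickIsotropyInfo_iff] at hKick
  rw [contactChaos_iff]
  intro a₀ θ₀ u₀ ha hθ hu ha0 hθ0
  obtain ⟨σ₁, hσ₁, H1⟩ := h1 a₀ θ₀ u₀ ha hθ hu ha0 hθ0
  obtain ⟨σ₃, hσ₃, H3⟩ := h3 a₀ θ₀ u₀ ha hθ hu ha0 hθ0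
  obtain ⟨σK, hσK, HK⟩ := hKick a₀ θ₀ u₀ ha hθ hu ha0 hθ0
  refine ⟨min σ₁ (min σ₃ σK), lt_min hσ₁ (lt_min hσ₃ hσK), fun σ hσ hσlt Φ τ hτ χ hχ Ψ hΨ hΨb η δ hη hδ => ?_⟩
  have hlt1 : σ < σ₁ := lt_of_lt_of_le hσlt (min_le_left _ _)
  have hlt3 : σ < σ₃ := lt_of_lt_of_le hσlt ((min_le_right _ _).trans (min_le_left _ _))
  have hltK : σ < σK := lt_of_lt_of_le hσlt ((min_le_right _ _).trans (min_le_right _ _))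
  -- S1 at (η/2, δ/3): the scale r₀
  obtain ⟨r₀, hr₀, H1r⟩ := H1 σ hσ hlt1 Φ τ hτ χ hχ Ψ hΨ hΨb (η / 2) (δ / 3) (by positivity) (by positivity)
  refine ⟨r₀, hr₀, fun r hr hrr => ?_⟩
  obtain ⟨N₁, H1N⟩ := H1r r hr hrr
  -- S3 at (η, δ/3, r): dictionary, constant, threshold
  obtain ⟨m₀, g, hgc, hgb, hgf, C, hC, N₃, H3N⟩ :=
    H3 σ hσ hlt3 Φ τ hτ χ hχ Ψ hΨ hΨb η (δ / 3) r hη (by positivity) hr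
  -- KickIsotropyInfo for each dictionary element, accuracy δK
  set δK : ℝ := δ / (3 * (C + 1) * ((m₀ : ℝ) + 1)) with hδK_def
  have hδK : 0 < δK := by positivity
  choose NK HK' using fun m : Fin m₀ => HK σ hσ hltK Φ τ hτ r hr (g m) (hgc m) (hgb m) (hgf m) δK hδK
  refine ⟨max N₁ (max N₃ (Finset.univ.sup NK)), fun N hN => ?_⟩
  have hN1 : N₁ ≤ N := (le_max_left _ _).trans hN
  have hN3 : N₃ ≤ N := ((le_max_left _ _).trans (le_max_right _ _)).trans hN
  have hNK : ∀ m, NK m ≤ N := fun m =>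
    ((Finset.le_sup (f := NK) (Finset.mem_univ m)).trans ((le_max_right _ _).trans (le_max_right _ _))).trans hN
  obtain ⟨s, hsm, hsb, Hdom⟩ := H3N N hN3
  have hKm : ∀ m : Fin m₀, ∫⁻ z, ENNReal.ofReal |kickFunctional σ N (Φ N) τ r (g m) (velWeight N (s m)) z|
      ∂(localGibbsLaw σ a₀ u₀ θ₀ N (Φ N)) ≤ ENNReal.ofReal δK :=
    fun m => HK' m N (hNK m) (velWeight N (s m)) (measurable_velWeight (hsm m)) (abs_velWeight_le (hsb m))
  calc localGibbsLaw σ a₀ u₀ θ₀ N (Φ N) {z | η < |trueDefect σ N (Φ N) τ χ Ψ r z|}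
      ≤ ((localGibbsLaw σ a₀ u₀ θ₀ N (Φ N)).prod kmDice) {q | η / 2 < |starDefect σ N τ χ Ψ r q|} +
          ENNReal.ofReal (δ / 3) +
          ENNReal.ofReal C * ∑ m : Fin m₀, ∫⁻ z, ENNReal.ofReal
            |kickFunctional σ N (Φ N) τ r (g m) (velWeight N (s m)) z| ∂(localGibbsLaw σ a₀ u₀ θ₀ N (Φ N)) := Hdom
    _ ≤ ENNReal.ofReal (δ / 3) + ENNReal.ofReal (δ / 3) + ENNReal.ofReal C * ∑ _m : Fin m₀, ENNReal.ofReal δK := by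
        gcongr with m
        · exact H1N N hN1
        · exact hKm m
    _ = ENNReal.ofReal (δ / 3 + δ / 3 + C * ((m₀ : ℝ) * δK)) := by
        rw [Finset.sum_const, Finset.card_univ, Fintype.card_fin, nsmul_eq_mul, ← ENNReal.ofReal_natCast,
          ← ENNReal.ofReal_mul (Nat.cast_nonneg _), ← ENNReal.ofReal_mul hC,
          ← ENNReal.ofReal_add (by positivity) (by positivity), ← ENNReal.ofReal_add (by positivity) (by positivity)]
    _ ≤ ENNReal.ofReal δ := ENNReal.ofReal_le_ofReal (budget_le hδ.le hC m₀)

/-- **`PercolationClosesChaos` from the line `stein-lindeberg-kick-swap` — the six registered stubs W1, W2, S1, S2,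
S3a, S3b give the crux BY NAME** (the lead's reshaped composition: W := `kickMatchedStationary_of` W1 W2, S3 :=
`kickAmbientDomination_of` (S3a W) (S3b W (S2 Spec W)), then the planner's `PercolationClosesChaos_of₄`). [folklore] -/
theorem PercolationClosesChaos_of (hW1 : Stubs.stub_kickMatchedMeasurable) (hW2 : Stubs.stub_kickMatchedStationaryCore)
    (hS1 : Stubs.stub_fairGasContactChaos) (hS2 : Stubs.stub_oneKickInfluence) (hS3a : Stubs.stub_swapIdentity)
    (hS3b : Stubs.stub_swapSumDomination) : PercolationClosesChaos :=
  have hW : KickMatchedStationary := kickMatchedStationary_of hW1 hW2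
  PercolationClosesChaos_of₄ hW hS1 hS2 fun hW' hO => kickAmbientDomination_of (hS3a hW') (hS3b hW' hO)

/-- **The skeleton concludes the crux BY NAME from the six registered stubs** (D-0027 §3.3 shape; the `stub_*`
theorems are the only `sorry`s; `#h21_check_skeleton`: theorem = this or `PercolationClosesChaos_of`). [folklore] -/
theorem PercolationClosesChaos_proof : PercolationClosesChaos :=
  PercolationClosesChaos_of stub_kickMatchedMeasurable stub_kickMatchedStationaryCore stub_fairGasContactChaos
    stub_oneKickInfluence stub_swapIdentity stub_swapSumDomination

end Summit.AtomisticToContinuum.HydrodynamicLimit.Cruxes.PercolationClosesChaos.SteinLindebergKickSwap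

end
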